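import Summits.BirchSwinnertonDyer.BirchSwinnertonDyer.Theorems.ShaPrimaryTransferFiniteShaComponentTransferZywinaEqualityDoor
import HarnessLib

/-!
# BirchSwinnertonDyer / ShaPrimaryTransfer — crux `FiniteShaComponentTransfer` (stmt-BirchSwinnertonDyer-22356):
# the equality door on Zywina's family is PRIME-UNIFORM — irreducibility at every `p` with `(−7/p) = −1`, and the
# `13`-adic door

Companion of `…ZywinaEqualityDoor` (the `5`-adic door).  The two member-level inputs of the door that depend on the
prime — `E_{m,n}[p]` irreducible and `p` good ordinary — are available at many primes, not only `p = 5`: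

* `map_zywinaCurveInt_zmod_of_dvd` — for EVERY `ℓ ∣ n`: `E_{m,n} mod ℓ = y² = x³ − 5m x² + 4m² x = x(x − m)(x − 4m)`,
  the quadratic twist by `m` of the fixed curve `E₀ : y² = x(x − 1)(x − 4)`; so `a_ℓ(E_{m,n}) = ± a_ℓ(E₀)` depends on
  `m mod ℓ` only, and `ℓ` is ORDINARY for `E_{m,n}` iff it is for `E₀` (all `ℓ ≥ 5` except the density-zero set of
  supersingular primes of `E₀`, e.g. `7, 47`).
* `hasIrreducibleModPGaloisRep_zywinaCurve_of_seven_dvd` — for `7 ∣ n` and ANY prime `p ≠ 7` with `X² + 7`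
  irreducible mod `p` (i.e. `(−7/p) = −1`: `p = 5, 13, 17, 19, 31, 41, …`): `E_{m,n}[p]` is irreducible (Mazur's
  Frobenius certificate at `ℓ = 7`, `a₇(E_{m,n}) = 0` from `…ZywinaEqualityDoor`).
* `goodOrdinary_thirteen_zywinaCurve` — `13 ∣ n ⟹ 13` is good ordinary for `E_{m,n}` (`#E_{m,n}(𝔽₁₃) ∈ {12, 16}`,
  twelve kernel-decided counts); `equalityDoor_thirteen_zywinaCurve` — for admissible `(m, n)` with `7·13 ∣ n` and
  Schneider's conjecture at `13` (THEOREM R* on the classes `zywinaClass 13 K m₁ M`), granting the two prints: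
  **`ord_{T=0} L_13(E_{m,n}, T) = 2 ⟺ Ш(E_{m,n})[13^∞]` finite**; `transfer_instance_iff_order_eq_two_thirteen` —
  T's instance `(E_{m,n}, 2, 13)` is that statement; `order_eq_two_at_five_and_thirteen_of_transfer` — T predicts
  `5`-adic AND `13`-adic BSD-rank simultaneously on members with `5·7·13 ∣ n`... granting R* at both primes.

PARTITION: r_an ≥ 2 side; S0 not touched (B1 honesty).  References: B. Mazur, Invent. Math. 44 (1978) Prop. 6.3;
D. Zywina, arXiv:2502.01957 Thm. 1.2, §3; J. H. Silverman, *AEC* VII.5, V.4; K. Ireland, M. Rosen, GTM 84 §18.4.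
-/

-- D-0017: single-problem summit, so `Summit.BirchSwinnertonDyer.BirchSwinnertonDyer.…` repeats a namespace BY DESIGN.
set_option linter.dupNamespace false

noncomputable section

namespace Summit.BirchSwinnertonDyer.BirchSwinnertonDyer.Theorems.ShaPrimaryTransferZywinaEqualityDoorPrimes

open scoped Classical MatrixGroups ModularForm
open CongruenceSubgroup
open Literature.NumberTheory.EllipticCurves Literature.NumberTheory.EllipticCurves.Zywina2025
  Literature.NumberTheory.EllipticCurves.ModularForms
open WeierstrassCurve
open Summit.BirchSwinnertonDyer.BirchSwinnertonDyer.Rank1Residual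
open Summit.BirchSwinnertonDyer.Rank1Residual.Additive
open Summit.BirchSwinnertonDyer.BirchSwinnertonDyer.Theses.ShaPrimaryTransfer (FiniteShaComponentTransfer)
open Summit.BirchSwinnertonDyer.BirchSwinnertonDyer.Theorems.ShaPrimaryTransferGoodOrdinaryFive
open Summit.BirchSwinnertonDyer.BirchSwinnertonDyer.Theorems.ShaPrimaryTransferZywinaEqualityDoor

variable {m n : ℕ}

/-! ## §1 The reduction of `E_{m,n}` at any prime `ℓ ∣ n`, and irreducibility at every `p` with `(−7/p) = −1` -/

/-- **`E_{m,n} mod ℓ = y² = x³ − 5m x² + 4m² x` for every `ℓ ∣ n`** (`q ≡ r ≡ m (mod ℓ)`): the quadratic twist by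
`m` of `E₀ : y² = x(x−1)(x−4)`. [cite: Zywina2025, Thm 1.2 (the model of E_{m,n})] -/
theorem map_zywinaCurveInt_zmod_of_dvd (ℓ : ℕ) [NeZero ℓ] (hℓ : ℓ ∣ n) :
    (zywinaCurveInt m n).map (Int.castRingHom (ZMod ℓ)) =
      ((⟨0, -5 * ((m : ℤ) % ℓ), 0, 4 * ((m : ℤ) % ℓ) ^ 2, 0⟩ : WeierstrassCurve ℤ).map
        (Int.castRingHom (ZMod ℓ))) := by
  have hn : ((n : ℕ) : ZMod ℓ) = 0 := by
    rw [ZMod.natCast_eq_zero_iff]; exact hℓ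
  ext
  · simp [zywinaCurveInt]
  · simp only [zywinaCurveInt, map_a₂, eq_intCast]
    push_cast
    rw [hn]; ring
  · simp [zywinaCurveInt]
  · simp only [zywinaCurveInt, map_a₄, eq_intCast]
    push_cast
    rw [hn]; ring
  · simp [zywinaCurveInt]

/-- **`E_{m,n}[p]` is irreducible for `7 ∣ n` and every prime `p ≠ 7` with `X² + 7` irreducible mod `p`**
(`(−7/p) = −1`; Mazur's Frobenius certificate at the good prime `ℓ = 7`, `a₇(E_{m,n}) = 0`). UNCONDITIONAL.
[cite: Mazur1978, §6 Prop. 6.3 (1) (p. 153)] -/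
theorem hasIrreducibleModPGaloisRep_zywinaCurve_of_seven_dvd (p : ℕ) [Fact p.Prime] (hp7 : 7 ≠ p)
    (h : ZywinaAdmissible m n) (h7 : 7 ∣ n)
    (hnoroot : ∀ t : ZMod p, t ^ 2 - ((0 : ℤ) : ZMod p) * t + ((7 : ℕ) : ZMod p) ≠ 0) :
    (zywinaCurve m n).HasIrreducibleModPGaloisRep p := by
  haveI : Fact (Nat.Prime 7) := ⟨by norm_num⟩
  rw [← map_zywinaCurveInt_rat]
  refine Rank2.hasIrreducibleModPGaloisRep_map_of_noroot (zywinaCurveInt m n) p 7 hp7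
    (seven_not_dvd_Δ_zywinaCurveInt h) ?_
  rw [frobeniusTrace_seven_zywinaCurveInt h h7]
  exact hnoroot

/-! ## §2 `13` is good ordinary on the members with `13 ∣ n` -/

/-- A prime `k ≡ 11 (mod 24)` is not `13`. [folklore] -/
theorem thirteen_not_dvd_of_prime_of_mod {k : ℕ} (hk : k.Prime) (hmod : k % 24 = 11) : ¬ (13 : ℤ) ∣ (k : ℤ) :=
  fun h ↦ by have := (Nat.prime_dvd_prime_iff_eq (by norm_num) hk).1 (by exact_mod_cast h : 13 ∣ k); omega

/-- **`13 ∤ Δ(E_{m,n}) = 2⁸·3²·m·q³·r²`**: `13` is a prime of good reduction of every `E_{m,n}`.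
[cite: Zywina2025, §3 (discriminant of E_{m,n})] -/
theorem thirteen_not_dvd_Δ_zywinaCurveInt (h : ZywinaAdmissible m n) : ¬ (13 : ℤ) ∣ (zywinaCurveInt m n).Δ := by
  have P := h.params
  have h13 : Prime (13 : ℤ) := Int.prime_iff_natAbs_prime.2 (by norm_num)
  have hm := thirteen_not_dvd_of_prime_of_mod P.m_prime P.m_mod
  have hq := thirteen_not_dvd_of_prime_of_mod P.q_prime P.q_mod
  have hr := thirteen_not_dvd_of_prime_of_mod P.r_prime P.r_mod
  rw [← P.q_eq] at hq
  rw [← P.r_eq] at hr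
  rw [zywinaCurveInt_Δ]
  intro hd
  rcases h13.dvd_or_dvd hd with h1 | h1
  · rcases h13.dvd_or_dvd h1 with h2 | h2
    · rcases h13.dvd_or_dvd h2 with h3 | h3
      · rcases h13.dvd_or_dvd h3 with h4 | h4
        · exact absurd (Int.Prime.dvd_pow' (by norm_num) h4) (by norm_num)
        · exact absurd (Int.Prime.dvd_pow' (by norm_num) h4) (by norm_num)
      · exact hm h3
    · exact hq (h13.dvd_of_dvd_pow h2)
  · exact hr (h13.dvd_of_dvd_pow h1)

/-- The residue `m % 13` is one of `1, …, 12`. [folklore] -/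
theorem residue_thirteen_mem (h : ZywinaAdmissible m n) :
    (m : ℤ) % 13 = 1 ∨ (m : ℤ) % 13 = 2 ∨ (m : ℤ) % 13 = 3 ∨ (m : ℤ) % 13 = 4 ∨
      (m : ℤ) % 13 = 5 ∨ (m : ℤ) % 13 = 6 ∨ (m : ℤ) % 13 = 7 ∨ (m : ℤ) % 13 = 8 ∨
      (m : ℤ) % 13 = 9 ∨ (m : ℤ) % 13 = 10 ∨ (m : ℤ) % 13 = 11 ∨ (m : ℤ) % 13 = 12 := by
  have P := h.params
  have hm := thirteen_not_dvd_of_prime_of_mod P.m_prime P.m_mod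
  have hne : (m : ℤ) % 13 ≠ 0 := fun h0 ↦ hm (Int.dvd_of_emod_eq_zero h0)
  omega

/-- **The twelve point counts over `𝔽₁₃`** of `y² = x³ − 5c x² + 4c² x`, `c = 1, …, 12`: each is `12` or `16`,
so `a₁₃ = ±2 ≢ 0 (mod 13)` (kernel-decided). [cite: IrelandRosen1990, §18.4] -/
theorem natCard_thirteen_of_residue (c : ℤ) (hc : c = 1 ∨ c = 2 ∨ c = 3 ∨ c = 4 ∨ c = 5 ∨ c = 6 ∨ c = 7 ∨ c = 8 ∨ c = 9 ∨ c = 10 ∨ c = 11 ∨ c = 12) :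
    ¬ (13 : ℤ) ∣ (13 : ℤ) + 1 -
      (Nat.card (((⟨0, -5 * c, 0, 4 * c ^ 2, 0⟩ : WeierstrassCurve ℤ).map
        (Int.castRingHom (ZMod 13))).toAffine.Point) : ℕ) := by
  rcases hc with rfl | rfl | rfl | rfl | rfl | rfl | rfl | rfl | rfl | rfl | rfl | rfl
  · rw [show (⟨0, -5 * 1, 0, 4 * 1 ^ 2, 0⟩ : WeierstrassCurve ℤ) = ⟨0, -5, 0, 4, 0⟩ by norm_num,
      PointCountNat.natCard_point_map_eq (hℓ := ⟨by norm_num⟩) (by norm_num) 0 (-5) 0 4 0 (by decide +kernel)]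
    decide +kernel
  · rw [show (⟨0, -5 * 2, 0, 4 * 2 ^ 2, 0⟩ : WeierstrassCurve ℤ) = ⟨0, -10, 0, 16, 0⟩ by norm_num,
      PointCountNat.natCard_point_map_eq (hℓ := ⟨by norm_num⟩) (by norm_num) 0 (-10) 0 16 0 (by decide +kernel)]
    decide +kernel
  · rw [show (⟨0, -5 * 3, 0, 4 * 3 ^ 2, 0⟩ : WeierstrassCurve ℤ) = ⟨0, -15, 0, 36, 0⟩ by norm_num,
      PointCountNat.natCard_point_map_eq (hℓ := ⟨by norm_num⟩) (by norm_num) 0 (-15) 0 36 0 (by decide +kernel)]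
    decide +kernel
  · rw [show (⟨0, -5 * 4, 0, 4 * 4 ^ 2, 0⟩ : WeierstrassCurve ℤ) = ⟨0, -20, 0, 64, 0⟩ by norm_num,
      PointCountNat.natCard_point_map_eq (hℓ := ⟨by norm_num⟩) (by norm_num) 0 (-20) 0 64 0 (by decide +kernel)]
    decide +kernel
  · rw [show (⟨0, -5 * 5, 0, 4 * 5 ^ 2, 0⟩ : WeierstrassCurve ℤ) = ⟨0, -25, 0, 100, 0⟩ by norm_num,
      PointCountNat.natCard_point_map_eq (hℓ := ⟨by norm_num⟩) (by norm_num) 0 (-25) 0 100 0 (by decide +kernel)]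
    decide +kernel
  · rw [show (⟨0, -5 * 6, 0, 4 * 6 ^ 2, 0⟩ : WeierstrassCurve ℤ) = ⟨0, -30, 0, 144, 0⟩ by norm_num,
      PointCountNat.natCard_point_map_eq (hℓ := ⟨by norm_num⟩) (by norm_num) 0 (-30) 0 144 0 (by decide +kernel)]
    decide +kernel
  · rw [show (⟨0, -5 * 7, 0, 4 * 7 ^ 2, 0⟩ : WeierstrassCurve ℤ) = ⟨0, -35, 0, 196, 0⟩ by norm_num,
      PointCountNat.natCard_point_map_eq (hℓ := ⟨by norm_num⟩) (by norm_num) 0 (-35) 0 196 0 (by decide +kernel)]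
    decide +kernel
  · rw [show (⟨0, -5 * 8, 0, 4 * 8 ^ 2, 0⟩ : WeierstrassCurve ℤ) = ⟨0, -40, 0, 256, 0⟩ by norm_num,
      PointCountNat.natCard_point_map_eq (hℓ := ⟨by norm_num⟩) (by norm_num) 0 (-40) 0 256 0 (by decide +kernel)]
    decide +kernel
  · rw [show (⟨0, -5 * 9, 0, 4 * 9 ^ 2, 0⟩ : WeierstrassCurve ℤ) = ⟨0, -45, 0, 324, 0⟩ by norm_num,
      PointCountNat.natCard_point_map_eq (hℓ := ⟨by norm_num⟩) (by norm_num) 0 (-45) 0 324 0 (by decide +kernel)]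
    decide +kernel
  · rw [show (⟨0, -5 * 10, 0, 4 * 10 ^ 2, 0⟩ : WeierstrassCurve ℤ) = ⟨0, -50, 0, 400, 0⟩ by norm_num,
      PointCountNat.natCard_point_map_eq (hℓ := ⟨by norm_num⟩) (by norm_num) 0 (-50) 0 400 0 (by decide +kernel)]
    decide +kernel
  · rw [show (⟨0, -5 * 11, 0, 4 * 11 ^ 2, 0⟩ : WeierstrassCurve ℤ) = ⟨0, -55, 0, 484, 0⟩ by norm_num,
      PointCountNat.natCard_point_map_eq (hℓ := ⟨by norm_num⟩) (by norm_num) 0 (-55) 0 484 0 (by decide +kernel)]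
    decide +kernel
  · rw [show (⟨0, -5 * 12, 0, 4 * 12 ^ 2, 0⟩ : WeierstrassCurve ℤ) = ⟨0, -60, 0, 576, 0⟩ by norm_num,
      PointCountNat.natCard_point_map_eq (hℓ := ⟨by norm_num⟩) (by norm_num) 0 (-60) 0 576 0 (by decide +kernel)]
    decide +kernel

/-- **`13` is a prime of good ORDINARY reduction of `E_{m,n}` whenever `13 ∣ n`** (global minimal model).
UNCONDITIONAL. [cite: SilvermanAEC2009, VII.5 Prop. 5.1 (a) and V.4] [cite: IrelandRosen1990, §18.4] -/
theorem goodOrdinary_thirteen_zywinaCurve (h : ZywinaAdmissible m n) (h13 : 13 ∣ n)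
    [(zywinaCurve m n).IsGloballyMinimal] [Fact (Nat.Prime 13)] :
    (zywinaCurve m n).HasGoodReductionAtPrime 13 ∧ ¬ ((13 : ℕ) : ℤ) ∣ (zywinaCurve m n).frobeniusTrace 13 := by
  have hI : integralModelInt (zywinaCurve m n) = zywinaCurveInt m n := by
    convert integralModelInt_zywinaCurve h
  refine ⟨hasGoodReductionAtPrime_of_not_dvd _ 13 ?_, ?_⟩
  · rw [IntModel.minimalDiscriminantInt_eq hI]
    exact_mod_cast thirteen_not_dvd_Δ_zywinaCurveInt h
  · rw [IntModel.frobeniusTrace_eq hI rfl, map_zywinaCurveInt_zmod_of_dvd 13 h13]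
    exact_mod_cast natCard_thirteen_of_residue _ (residue_thirteen_mem h)

/-! ## §3 The `13`-adic equality door -/

/-- `X² + 7` has no root modulo `13` (`(−7/13) = −1`; kernel-decided, no `Fact` instance in scope).
[cite: Mazur1978, §6 Prop. 6.3 (1)] -/
theorem noroot_thirteen_seven : ∀ t : ZMod 13, t ^ 2 - ((0 : ℤ) : ZMod 13) * t + ((7 : ℕ) : ZMod 13) ≠ 0 := by
  decide

/-- **THE `13`-ADIC EQUALITY DOOR ON ZYWINA'S FAMILY.** For admissible `(m, n)` with `7 ∣ n` and `13 ∣ n`, and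
Schneider's conjecture for `E_{m,n}` at `13` (`hReg`; THEOREM R* on every class `zywinaClass 13 K m₁ M`,
`Rank2.schneiderConjecture_of_mem_zywinaClass`), granting the prints `h85`, `hMC`:
**`ord_{T=0} L_13(E_{m,n}, T) = 2 ⟺ Ш(E_{m,n}/ℚ)[13^∞]` is finite.** CONDITIONAL on `h85`, `hMC`, `hReg`.
[cite: BalakrishnanMullerStein2015, Thm. 1.7] [cite: BurungaleCastellaSkinner2025, Thm. 1.1.2 (a)] [cite: Zywina2025, Thm 1.2] -/
theorem equalityDoor_thirteen_zywinaCurve [Fact (Nat.Prime 13)] (h85 : Schneider1985_order_charGenerator)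
    (hMC : burungale_castella_skinner_charIdeal_eq_padicLFunction) (h : ZywinaAdmissible m n) (h7 : 7 ∣ n)
    (h13 : 13 ∣ n) [(zywinaCurve m n).IsElliptic] [(zywinaCurve m n).IsGloballyMinimal]
    (hReg : ∀ D : PAdicHeightData (zywinaCurve m n) 13, D.IsCanonical → SchneiderConjecture D)
    {N : ℕ} [NeZero N] {f : CuspForm (Gamma0 N) 2} (hf : IsNewformOf (zywinaCurve m n) f) :
    (padicLFunction f (unitRoot (zywinaCurve m n) 13 : ℚ_[13])).order = 2 ↔
      Finite (AddCommGroup.primaryComponent (zywinaCurve m n).sha 13) := by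
  obtain ⟨hgood, hord⟩ := goodOrdinary_thirteen_zywinaCurve h h13
  have hiff := order_padicLFunction_eq_rank_iff_finite_sha (zywinaCurve m n) 13 h85 hMC (by norm_num) hgood hord
    (hasIrreducibleModPGaloisRep_zywinaCurve_of_seven_dvd 13 (by norm_num) h h7 noroot_thirteen_seven) hReg hf
  rw [mordellWeilRank_zywinaCurve h] at hiff
  exact_mod_cast hiff

/-- **T's instance `(E_{m,n}, 2, 13)` IS the `13`-adic BSD-rank statement** (admissible `(m,n)`, `7·13 ∣ n`,
Schneider at `13`, the two prints). CONDITIONAL on `h85`, `hMC`, `hReg`. [cite: Zywina2025, Thm 1.2]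
[cite: BalakrishnanMullerStein2015, Thm. 1.7] -/
theorem transfer_instance_iff_order_eq_two_thirteen [Fact (Nat.Prime 13)] [Fact (Nat.Prime 2)]
    (h85 : Schneider1985_order_charGenerator) (hMC : burungale_castella_skinner_charIdeal_eq_padicLFunction)
    (h : ZywinaAdmissible m n) (h7 : 7 ∣ n) (h13 : 13 ∣ n) [(zywinaCurve m n).IsElliptic]
    [(zywinaCurve m n).IsGloballyMinimal]
    (hReg : ∀ D : PAdicHeightData (zywinaCurve m n) 13, D.IsCanonical → SchneiderConjecture D)
    {N : ℕ} [NeZero N] {f : CuspForm (Gamma0 N) 2} (hf : IsNewformOf (zywinaCurve m n) f) :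
    ((zywinaCurve m n).shaCorank 2 = 0 → (zywinaCurve m n).shaCorank 13 = 0) ↔
      (padicLFunction f (unitRoot (zywinaCurve m n) 13 : ℚ_[13])).order = 2 := by
  rw [equalityDoor_thirteen_zywinaCurve h85 hMC h h7 h13 hReg hf, finite_primaryComponent_sha_iff_shaCorank_eq_zero]
  exact ⟨fun hh ↦ hh (shaCorank_two_zywinaCurve h), fun hh _ ↦ hh⟩

/-- **T PREDICTS `5`-adic AND `13`-adic BSD-rank simultaneously** on the members with `7 ∣ n`, `13 ∣ n`, granting
the two prints and Schneider at `5` and at `13`: `ord_{T=0} L_5(E_{m,n}) = 2 ∧ ord_{T=0} L_13(E_{m,n}) = 2` — two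
independent refutation handles for T on one curve. CONDITIONAL on `hT`, `h85`, `hMC`, `hReg5`, `hReg13`.
[cite: Zywina2025, Thm 1.2] [cite: BalakrishnanMullerStein2015, Thm. 1.7] -/
theorem order_eq_two_at_five_and_thirteen_of_transfer [Fact (Nat.Prime 5)] [Fact (Nat.Prime 13)]
    (hT : FiniteShaComponentTransfer) (h85 : Schneider1985_order_charGenerator)
    (hMC : burungale_castella_skinner_charIdeal_eq_padicLFunction) (h : ZywinaAdmissible m n) (h7 : 7 ∣ n)
    (h13 : 13 ∣ n) [(zywinaCurve m n).IsElliptic] [(zywinaCurve m n).IsGloballyMinimal]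
    (hReg5 : ∀ D : PAdicHeightData (zywinaCurve m n) 5, D.IsCanonical → SchneiderConjecture D)
    (hReg13 : ∀ D : PAdicHeightData (zywinaCurve m n) 13, D.IsCanonical → SchneiderConjecture D)
    {N : ℕ} [NeZero N] {f : CuspForm (Gamma0 N) 2} (hf : IsNewformOf (zywinaCurve m n) f) :
    (padicLFunction f (unitRoot (zywinaCurve m n) 5 : ℚ_[5])).order = 2 ∧
      (padicLFunction f (unitRoot (zywinaCurve m n) 13 : ℚ_[13])).order = 2 := by
  haveI : Fact (Nat.Prime 2) := ⟨Nat.prime_two⟩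
  refine ⟨order_eq_two_of_transfer_zywinaCurve hT h85 hMC h h7 hReg5 hf, ?_⟩
  exact (transfer_instance_iff_order_eq_two_thirteen h85 hMC h h7 h13 hReg13 hf).mp
    (fun _ ↦ hT (zywinaCurve m n) 2 13 (shaCorank_two_zywinaCurve h))

end Summit.BirchSwinnertonDyer.BirchSwinnertonDyer.Theorems.ShaPrimaryTransferZywinaEqualityDoorPrimes

end
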